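import Summits.AnomalousDissipation.AnomalousDissipation.Theorems.MarginalStabilityChainBurgersLayerKHStubStrainedC
import Summits.AnomalousDissipation.AnomalousDissipation.Theorems.MarginalStabilityChainBurgersLayerKHStubRayleighJost
import Summits.AnomalousDissipation.AnomalousDissipation.Theorems.MarginalStabilityChainBurgersLayerKHStubSheetLimitA

/-!
# Line `Sketch`, stub `stub_strained` (lead) — part D

part D: regularity of Volterra-type functions `m = c₀ + ∫_{t>y} k_α f` (`volterra_regularity`), `peg` integrability,
weights and sources (`gaussBound_source`), `ou` bounds/continuity and kernel integrability — the tools of the fixed-point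
construction of part E.
-/

set_option linter.dupNamespace false

noncomputable section

open Complex MeasureTheory Filter Topology Set Metric intervalIntegral

namespace Summit.AnomalousDissipation.AnomalousDissipation.Theorems.BurgersLayerKH.Sheet.Strained

/-! ## §F Regularity of Volterra-type functions `m = c₀ + ∫_{t>y} k_α(t-y) f(t) dt` -/

/-- A continuous function of the `peg` class is integrable, and so is `e^{ct} f` for every `c`.
[folklore] -/
theorem integrable_peg {f : ℝ → ℂ} (hf : Continuous f) {M : ℝ} {n : ℕ} {a : ℝ}
    (hb : ∀ t, ‖f t‖ ≤ M * ((1 + |t|) ^ n * Real.exp (a * t) * Real.exp (-(t ^ 2) / 4))) (c : ℝ) :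
    Integrable f ∧ Integrable fun t => (Real.exp (c * t) : ℂ) * f t := by
  obtain ⟨C, -, hC⟩ := peg_integral_bound n a
  obtain ⟨C', -, hC'⟩ := peg_integral_bound n (a + c)
  refine ⟨(hC f hf M hb).1, (hC' _ (by fun_prop) M fun t => ?_).1⟩
  rw [norm_mul, Complex.norm_real, Real.norm_of_nonneg (Real.exp_pos _).le]
  calc Real.exp (c * t) * ‖f t‖ ≤ Real.exp (c * t) * (M * ((1 + |t|) ^ n * Real.exp (a * t) * Real.exp (-(t ^ 2) / 4))) :=
        mul_le_mul_of_nonneg_left (hb t) (Real.exp_pos _).le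
    _ = M * ((1 + |t|) ^ n * Real.exp ((a + c) * t) * Real.exp (-(t ^ 2) / 4)) := by
        rw [show (a + c) * t = a * t + c * t by ring, Real.exp_add]; ring

/-- **Regularity of Volterra-type functions.** For `α > 0`, a continuous `f` with `f` and
`e^{-2αt} f` integrable, and `m(y) = c₀ + ∫_{t>y} k_α(t-y) f(t) dt`: `m` is differentiable,
`D := m' = -e^{2αy} ∫_{t>y} e^{-2αt} f` satisfies `D' = 2α D + f` (so `m'' - 2α m' = f`),
`‖m(y) - c₀‖ ≤ (2α)⁻¹ ∫_{t>y} ‖f‖`, and `m(y) → c₀` as `y → +∞`.  (Adapted from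
`RayleighJost.jost_regularity`.) [folklore] -/
theorem volterra_regularity {α : ℝ} (hα : 0 < α) {f : ℝ → ℂ} (hfc : Continuous f) (hfi : Integrable f)
    (hgi : Integrable fun t => (Real.exp (-(2 * α * t)) : ℂ) * f t) (c₀ : ℂ) {m : ℝ → ℂ}
    (hm : ∀ y, m y = c₀ + ∫ t in Ioi y, (volterraKernel α (t - y) : ℂ) * f t) :
    ∃ D : ℝ → ℂ, (∀ y, HasDerivAt m (D y) y) ∧ (∀ y, HasDerivAt D (2 * α * D y + f y) y) ∧
      (∀ y, ‖m y - c₀‖ ≤ 1 / (2 * α) * ∫ t in Ioi y, ‖f t‖) ∧ Tendsto m atTop (𝓝 c₀) := by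
  set G : ℝ → ℂ := fun t => (Real.exp (-(2 * α * t)) : ℂ) * f t with hG
  have hGc : Continuous G := by simp only [hG]; fun_prop
  -- the kernel, split into its two exponentials
  have hker : ∀ y t, (volterraKernel α (t - y) : ℂ) * f t =
      (1 / (2 * α) : ℂ) * f t - (Real.exp (2 * α * y) : ℂ) / (2 * α) * G t := by
    intro y t
    have hk : volterraKernel α (t - y) =
        (1 - Real.exp (2 * α * y) * Real.exp (-(2 * α * t))) / (2 * α) := by
      rw [← Real.exp_add, show 2 * α * y + -(2 * α * t) = -(2 * α * (t - y)) by ring]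
      simp [volterraKernel, hα.ne']
    rw [hk, hG]
    push_cast
    ring
  have hint : ∀ y, ∫ t in Ioi y, (volterraKernel α (t - y) : ℂ) * f t =
      (1 / (2 * α) : ℂ) * (∫ t in Ioi y, f t) -
        (Real.exp (2 * α * y) : ℂ) / (2 * α) * ∫ t in Ioi y, G t := by
    intro y
    simp_rw [hker y]
    rw [integral_sub ((hfi.const_mul _).integrableOn) ((hgi.const_mul _).integrableOn),
      MeasureTheory.integral_const_mul, MeasureTheory.integral_const_mul]
  -- derivatives
  have hPd : ∀ y, HasDerivAt (fun x => ∫ t in Ioi x, f t) (-f y) y :=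
    RayleighJost.hasDerivAt_integral_Ioi hfc hfi
  have hQd : ∀ y, HasDerivAt (fun x => ∫ t in Ioi x, G t) (-G y) y :=
    RayleighJost.hasDerivAt_integral_Ioi hGc hgi
  have hE : ∀ y, HasDerivAt (fun x => (Real.exp (2 * α * x) : ℂ))
      ((Real.exp (2 * α * y) * (2 * α) : ℝ) : ℂ) y := fun y => (hasDerivAt_expLin (2 * α) y).ofReal_comp
  have hEG : ∀ y, (Real.exp (2 * α * y) : ℂ) * G y = f y := by
    intro y
    simp only [hG]
    rw [← mul_assoc, ← Complex.ofReal_mul, ← Real.exp_add, add_neg_cancel, Real.exp_zero,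
      Complex.ofReal_one, one_mul]
  have hα2 : (α : ℂ) ≠ 0 := by exact_mod_cast hα.ne'
  have hR : ∀ y, HasDerivAt (fun x => c₀ + (1 / (2 * α) : ℂ) * (∫ t in Ioi x, f t) -
      (Real.exp (2 * α * x) : ℂ) / (2 * α) * ∫ t in Ioi x, G t)
      ((1 / (2 * α) : ℂ) * (-f y) - (((Real.exp (2 * α * y) * (2 * α) : ℝ) : ℂ) / (2 * α) *
        (∫ t in Ioi y, G t) + (Real.exp (2 * α * y) : ℂ) / (2 * α) * (-G y))) y := fun y =>
    (((hPd y).const_mul _).const_add _).fun_sub (((hE y).div_const _).fun_mul (hQd y))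
  have hmD : ∀ y, HasDerivAt m (-(Real.exp (2 * α * y) : ℂ) * ∫ t in Ioi y, G t) y := by
    intro y
    have hfun : m = fun x => c₀ + (1 / (2 * α) : ℂ) * (∫ t in Ioi x, f t) -
        (Real.exp (2 * α * x) : ℂ) / (2 * α) * ∫ t in Ioi x, G t := by
      funext x; rw [hm x, hint x]; ring
    rw [hfun]
    refine (hR y).congr_deriv ?_
    rw [← hEG y]
    push_cast
    field_simp
    ring
  have hDd : ∀ y, HasDerivAt (fun x => -(Real.exp (2 * α * x) : ℂ) * ∫ t in Ioi x, G t)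
      (2 * α * (-(Real.exp (2 * α * y) : ℂ) * ∫ t in Ioi y, G t) + f y) y := by
    intro y
    refine ((hE y).fun_neg.fun_mul (hQd y)).congr_deriv ?_
    rw [← hEG y]
    push_cast
    ring
  -- tail bound and limit
  have hbound : ∀ y, ‖m y - c₀‖ ≤ 1 / (2 * α) * ∫ t in Ioi y, ‖f t‖ := by
    intro y
    rw [hm y, add_sub_cancel_left, ← MeasureTheory.integral_const_mul]
    refine norm_integral_le_of_norm_le ((hfi.norm.const_mul _).integrableOn) ?_
    rw [ae_restrict_iff' measurableSet_Ioi]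
    refine ae_of_all _ fun t (ht : y < t) => ?_
    obtain ⟨hk0, hk1⟩ := volterraKernel_bounds hα (sub_nonneg.2 ht.le)
    rw [norm_mul, Complex.norm_of_nonneg hk0]
    exact mul_le_mul_of_nonneg_right hk1 (norm_nonneg _)
  refine ⟨fun x => -(Real.exp (2 * α * x) : ℂ) * ∫ t in Ioi x, G t, hmD, hDd, hbound, ?_⟩
  have hT : Tendsto (fun y => ∫ t in Ioi y, ‖f t‖) atTop (𝓝 0) := RayleighJost.tendsto_integral_Ioi_atTop hfi.norm
  rw [tendsto_iff_norm_sub_tendsto_zero]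
  refine squeeze_zero (fun y => norm_nonneg _) hbound ?_
  simpa using hT.const_mul (1 / (2 * α))

/-- `ou` is additive on `C²` functions. [folklore] -/
theorem ou_sub {α : ℝ} {ω₁ ω₂ : ℝ → ℂ} (h₁ : ContDiff ℝ 2 ω₁) (h₂ : ContDiff ℝ 2 ω₂) (y : ℝ) :
    ou α (fun t => ω₁ t - ω₂ t) y = ou α ω₁ y - ou α ω₂ y := by
  have hd1 : Differentiable ℝ ω₁ := h₁.differentiable (by norm_num)
  have hd2 : Differentiable ℝ ω₂ := h₂.differentiable (by norm_num)
  have hd1' : Differentiable ℝ (deriv ω₁) :=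
    ((show ContDiff ℝ (1 + 1) ω₁ from h₁).deriv').differentiable (by norm_num)
  have hd2' : Differentiable ℝ (deriv ω₂) :=
    ((show ContDiff ℝ (1 + 1) ω₂ from h₂).deriv').differentiable (by norm_num)
  have hsub : (fun t => ω₁ t - ω₂ t) = ω₁ - ω₂ := rfl
  have e1 : deriv (fun t => ω₁ t - ω₂ t) = fun t => deriv ω₁ t - deriv ω₂ t := by
    funext t; rw [hsub, deriv_sub (hd1 t) (hd2 t)]
  have e2 : iteratedDeriv 2 (fun t => ω₁ t - ω₂ t) y = iteratedDeriv 2 ω₁ y - iteratedDeriv 2 ω₂ y := by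
    rw [iteratedDeriv_two_eq, iteratedDeriv_two_eq, iteratedDeriv_two_eq, e1]
    have : (fun t => deriv ω₁ t - deriv ω₂ t) = deriv ω₁ - deriv ω₂ := rfl
    rw [this, deriv_sub (hd1' y) (hd2' y)]
  simp only [ou, e1, e2]
  ring

/-! ## §G The strained slow mode as a fixed point (existence) -/

/-- A Gaussian bound may be weakened. [folklore] -/
theorem GaussBound.mono {F : ℝ → ℂ} {C C' : ℝ} (hF : GaussBound F C) (h : C ≤ C') : GaussBound F C' :=
  fun y => (hF y).trans (mul_le_mul_of_nonneg_right h (Real.exp_pos _).le)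

/-- The source `F = -iU''·e^{-αt}·m` of a linearly bounded `m` is of Gaussian class `e⁹ B`.
[folklore] -/
theorem gaussBound_source {α B : ℝ} (hα : 0 ≤ α) (hα1 : α ≤ 1) {m : ℝ → ℂ}
    (hm : ∀ t, ‖m t‖ ≤ B * (1 + |t|)) :
    GaussBound (fun t => -(I * Upp t) * ((Real.exp (-(α * t)) : ℂ) * m t)) (Real.exp 9 * B) := by
  intro t
  have hB : 0 ≤ B := by
    have := (norm_nonneg _).trans (hm 0); simpa using this
  rw [norm_mul, norm_neg, norm_mul, Complex.norm_I, one_mul, norm_mul, Complex.norm_real, Complex.norm_real,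
    Real.norm_eq_abs, Real.norm_of_nonneg (Real.exp_pos _).le]
  have hU : |Upp t| = |t| * Real.exp (-(t ^ 2) / 2) := by
    rw [Upp, abs_neg, abs_mul, abs_of_pos (Real.exp_pos _)]
  rw [hU]
  calc |t| * Real.exp (-(t ^ 2) / 2) * (Real.exp (-(α * t)) * ‖m t‖)
      ≤ |t| * Real.exp (-(t ^ 2) / 2) * (Real.exp (-(α * t)) * (B * (1 + |t|))) := by gcongr; exact hm t
    _ = B * (|t| * (1 + |t|) * Real.exp (-(t ^ 2) / 2) * Real.exp (-(α * t))) := by ring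
    _ ≤ B * (Real.exp 9 * Real.exp (-(t ^ 2) / 4)) := mul_le_mul_of_nonneg_left (RayleighJost.weight_le hα hα1 t) hB
    _ = Real.exp 9 * B * Real.exp (-(t ^ 2) / 4) := by ring

/-- Size of `ou α ω` for a resolvent solution (only used to kill boundary terms): with
`h·ou(ω) = (λ+iU)ω - F`, `‖ou α ω t‖ ≤ D'(1+|t|)e^{-t²/4}`. [folklore] -/
theorem ou_bound_of_resSol {α h : ℝ} {lam : ℂ} {F ω : ℝ → ℂ} (hs : IsResolventSol α h lam F ω) (hh : 0 < h)
    {C_F Cω : ℝ} (hF : GaussBound F C_F) (hω : GaussBound ω Cω) :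
    ∃ D' : ℝ, ∀ t, ‖ou α ω t‖ ≤ D' * (1 + |t|) * Real.exp (-(t ^ 2) / 4) := by
  have hC0 : 0 ≤ Cω := GaussBound.nonneg hω
  have hCF0 : 0 ≤ C_F := GaussBound.nonneg hF
  refine ⟨((‖lam‖ + 1) * Cω + C_F) / h, fun t => ?_⟩
  have he := hs.2.2 t
  have hne : (h : ℂ) ≠ 0 := by exact_mod_cast hh.ne'
  have hou : ou α ω t = ((lam + I * U t) * ω t - F t) / h := by
    rw [eq_div_iff hne]; linear_combination -he
  rw [hou, norm_div, Complex.norm_real, Real.norm_of_nonneg hh.le]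
  rw [div_mul_eq_mul_div, div_mul_eq_mul_div, le_div_iff₀ hh, div_mul_cancel₀ _ hh.ne']
  have ht0 : 0 ≤ |t| := abs_nonneg t
  calc ‖(lam + I * U t) * ω t - F t‖ ≤ ‖(lam + I * U t) * ω t‖ + ‖F t‖ := norm_sub_le _ _
    _ ≤ (‖lam‖ + |t|) * (Cω * Real.exp (-(t ^ 2) / 4)) + C_F * Real.exp (-(t ^ 2) / 4) := by
        refine add_le_add ?_ (hF t)
        rw [norm_mul]; exact mul_le_mul (norm_lam_add_le lam t) (hω t) (norm_nonneg _) (by positivity)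
    _ ≤ ((‖lam‖ + 1) * Cω + C_F) * (1 + |t|) * Real.exp (-(t ^ 2) / 4) := by
        have e0 : 0 < Real.exp (-(t ^ 2) / 4) := Real.exp_pos _
        have key : (‖lam‖ + |t|) * Cω + C_F ≤ ((‖lam‖ + 1) * Cω + C_F) * (1 + |t|) := by
          have : 0 ≤ ‖lam‖ * Cω * |t| + Cω + C_F * |t| := by positivity
          nlinarith [this]
        have := mul_le_mul_of_nonneg_right key e0.le
        refine le_trans (le_of_eq (by ring)) this

/-- `ou α ω` is continuous for `ω ∈ C²`. [folklore] -/
theorem continuous_ou {α : ℝ} {ω : ℝ → ℂ} (hω : ContDiff ℝ 2 ω) : Continuous (ou α ω) := by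
  have hωd : Differentiable ℝ ω := hω.differentiable (by norm_num)
  have hω1 : ContDiff ℝ 1 (deriv ω) := (show ContDiff ℝ (1 + 1) ω from hω).deriv'
  have hωd' : Differentiable ℝ (deriv ω) := hω1.differentiable (by norm_num)
  have hω2c : Continuous (deriv (deriv ω)) := hω1.continuous_deriv le_rfl
  have : ou α ω = fun t => deriv (deriv ω) t + (t : ℂ) * deriv ω t + (1 - (α : ℂ) ^ 2) * ω t := by
    funext t; simp only [ou, iteratedDeriv_two_eq]
  rw [this]
  exact (hω2c.add (continuous_ofReal.mul hωd'.continuous)).add (continuous_const.mul hωd.continuous)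

/-- Integrability of `t ↦ k_α(t-y) V(t) s(t)` on `(y, ∞)` for a Gaussian-class `V` and a linearly
bounded continuous `s`. [folklore] -/
theorem integrableOn_kernel {α A B : ℝ} (hα : 0 < α) {V s : ℝ → ℂ} (hVc : Continuous V)
    (hVb : ∀ t, ‖V t‖ ≤ A * Real.exp (-(t ^ 2) / 4)) (hsc : Continuous s) (hsb : ∀ t, ‖s t‖ ≤ B * (1 + |t|))
    (y : ℝ) : IntegrableOn (fun t => (volterraKernel α (t - y) : ℂ) * V t * s t) (Ioi y) := by
  obtain ⟨C, -, hC⟩ := peg_setIntegral_bound 1 0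
  have hA : 0 ≤ A := by have := (norm_nonneg _).trans (hVb 0); simpa using this
  have hkc : Continuous fun t => (volterraKernel α (t - y) : ℂ) := by
    have : (fun t => (volterraKernel α (t - y) : ℂ)) = fun t => (((1 - Real.exp (-(2 * α * (t - y)))) / (2 * α) : ℝ) : ℂ) := by
      funext t; rw [volterraKernel_of_ne hα.ne']
    rw [this]; fun_prop
  refine (hC (fun t => (volterraKernel α (t - y) : ℂ) * V t * s t) ((hkc.mul hVc).mul hsc)
    (1 / (2 * α) * A * B) y fun t ht => ?_).1
  obtain ⟨hk0, hk1⟩ := volterraKernel_bounds hα (sub_nonneg.2 ht)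
  rw [norm_mul, norm_mul, Complex.norm_of_nonneg hk0, pow_one, zero_mul, Real.exp_zero, mul_one]
  calc volterraKernel α (t - y) * ‖V t‖ * ‖s t‖ ≤ 1 / (2 * α) * (A * Real.exp (-(t ^ 2) / 4)) * (B * (1 + |t|)) :=
        mul_le_mul (mul_le_mul hk1 (hVb t) (norm_nonneg _) (by positivity)) (hsb t) (norm_nonneg _) (by positivity)
    _ = 1 / (2 * α) * A * B * ((1 + |t|) * Real.exp (-(t ^ 2) / 4)) := by ring

/-- Integrability of `t ↦ k_α(t-y) e^{αt} q(t)` on `(y, ∞)` for `q` with a `(1+|t|)e^{-t²/4}` bound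
(e.g. `q = ou(ω)/(λ+iU)`), and the rewriting `k·e^{αt}·q = k·(e^{αt} q)`. [folklore] -/
theorem integrableOn_kernel_exp {α M : ℝ} (hα : 0 < α) {q : ℝ → ℂ} (hqc : Continuous q)
    (hqb : ∀ t, ‖q t‖ ≤ M * (1 + |t|) * Real.exp (-(t ^ 2) / 4)) (y : ℝ) :
    IntegrableOn (fun t => (volterraKernel α (t - y) : ℂ) * (Real.exp (α * t) : ℂ) * q t) (Ioi y) := by
  obtain ⟨C, -, hC⟩ := peg_setIntegral_bound 1 α
  have hM : 0 ≤ M := by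
    have := (norm_nonneg _).trans (hqb 0); simpa using this
  have hkc : Continuous fun t => (volterraKernel α (t - y) : ℂ) := by
    have : (fun t => (volterraKernel α (t - y) : ℂ)) = fun t => (((1 - Real.exp (-(2 * α * (t - y)))) / (2 * α) : ℝ) : ℂ) := by
      funext t; rw [volterraKernel_of_ne hα.ne']
    rw [this]; fun_prop
  refine (hC (fun t => (volterraKernel α (t - y) : ℂ) * (Real.exp (α * t) : ℂ) * q t) ((hkc.mul (by fun_prop)).mul hqc)
    (1 / (2 * α) * M) y fun t ht => ?_).1
  obtain ⟨hk0, hk1⟩ := volterraKernel_bounds hα (sub_nonneg.2 ht)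
  rw [norm_mul, norm_mul, Complex.norm_of_nonneg hk0, Complex.norm_real, Real.norm_of_nonneg (Real.exp_pos _).le,
    pow_one]
  calc volterraKernel α (t - y) * Real.exp (α * t) * ‖q t‖
      ≤ 1 / (2 * α) * Real.exp (α * t) * (M * (1 + |t|) * Real.exp (-(t ^ 2) / 4)) :=
        mul_le_mul (mul_le_mul_of_nonneg_right hk1 (Real.exp_pos _).le) (hqb t) (norm_nonneg _) (by positivity)
    _ = 1 / (2 * α) * M * ((1 + |t|) * Real.exp (α * t) * Real.exp (-(t ^ 2) / 4)) := by ring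

end Summit.AnomalousDissipation.AnomalousDissipation.Theorems.BurgersLayerKH.Sheet.Strained

end
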